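import Summits.Ventures.CertifiedArithmetic.LowPrec.AccumulateLangeRump
import Summits.Ventures.CertifiedArithmetic.LowPrec.GemmTieChains
import Summits.Ventures.CertifiedArithmetic.LowPrec.Monotone

/-!
# Sharpness of the Lange–Rump constant: attained for every `n`, and the restriction is needed

HONEST FRAMING (venture CertifiedArithmetic / cell `pub-lowprec`): certified error envelopes and
provably optimal rounding/accumulation schemes for low-precision formats under stated cost models;
every table by two implementations; no hardware or vendor claims.

Two complements to `AccumulateLangeRump.lean` (`|ŝ - s| ≤ (n-1)u/(1+(n-1)u)·Σ|xᵢ|` for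
`n - 1 ≤ ½u⁻¹`), both for `bfloat16` (`u = 2^-8`, `½u⁻¹ = 128`):
* ATTAINED FOR EVERY LENGTH [LangeRump2018, Remark 2]: recursive summation with ties-to-even of
  `(1, u, u, …)` keeps `ŝₖ = 1` for every `k` (each `1 + u` is a tie resolved to the even `1`),
  so `|ŝₖ - sₖ| = k·u = k u/(1+k u) · Σ|xᵢ|` for EVERY `k` (`langeRump_attained_all_BFloat16`,
  via the cell's stationary tie-chain lemma `tieChain_spec`);
* THE RESTRICTION IS NEEDED (kernel, [LangeRump2018, Remark 2]'s example): with
  `t = u + 2u²`, recursive summation of `(1, t, u, t, u, …, t, u, 2t, 2u)` — 128 alternating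
  terms, then two doubled ones in the next binade — has `k = 130 = ½u⁻¹ + 2` additions and
  `|ŝ - s| = 8415/16384 > 130u/(1+130u) · Σ|xᵢ| = 1616225/3162112` (`Σ|xᵢ| = s = 24865/16384`,
  `ŝ = 65/32`): `langeRump_fails_at_130_BFloat16`. So in bfloat16 the theorem holds for
  `n ≤ 129` and fails for some data at `n = 131`; `n = 130` is not decided here (the paper:
  "the tolerance to the restriction of n is not greater than β/2").
-/

namespace Literature.ComputerArithmetic.FloatingPoint

namespace MiniFloat

open Finset

/-- The Lange–Rump extremal data `(1, u, u, …)` for bfloat16. [cite: LangeRump2018, Remark 2] -/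
def lrOnes (i : ℕ) : ℚ := if i = 0 then 1 else 1 / 256

/-- ATTAINED FOR EVERY `k` (bfloat16): `ŝₖ = 1`, `Σ_{i≤k} xᵢ = Σ|xᵢ| = 1 + k u`, hence
`|ŝₖ - sₖ| = k u/(1 + k u) · Σ_{i≤k}|xᵢ|` with equality, for all `k`. [cite: LangeRump2018, Remark 2] -/
theorem langeRump_attained_all_BFloat16 (k : ℕ) :
    (seqSum Format.BFloat16 lrOnes k).toRat = 1 ∧
    |(seqSum Format.BFloat16 lrOnes k).toRat - ∑ i ∈ range (k + 1), lrOnes i|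
      = (k : ℚ) * Format.BFloat16.unitRoundoff / (1 + (k : ℚ) * Format.BFloat16.unitRoundoff)
        * ∑ i ∈ range (k + 1), |lrOnes i| := by
  have hx : ∀ j, 0 < j → lrOnes j = 1 / 256 := fun j hj => by simp [lrOnes, Nat.pos_iff_ne_zero.mp hj]
  have h0 : (seqSum Format.BFloat16 lrOnes 0).toRat = 1 := by decide +kernel
  have hfix : (roundNE Format.BFloat16 (1 + 1 / 256)).toRat = 1 := by decide +kernel
  have hS : ∑ i ∈ range (0 + 1), lrOnes i = 1 := by simp [lrOnes]
  have hΛ : ∑ i ∈ range (0 + 1), |lrOnes i| = 1 := by simp [lrOnes]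
  obtain ⟨h1, h2, h3⟩ := tieChain_spec (α := Format.BFloat16) lrOnes 0 (1 / 256) 1 1 1 hx h0 hfix
    hS hΛ k (Nat.zero_le k)
  refine ⟨h1, ?_⟩
  rw [h1, h2, h3]
  have hu : Format.BFloat16.unitRoundoff = 1 / 256 := by
    rw [Format.unitRoundoff_eq]; norm_num [Format.BFloat16]
  rw [hu]
  have hk : (0 : ℚ) ≤ k := Nat.cast_nonneg k
  rw [abs_of_nonneg (by norm_num : (0 : ℚ) ≤ 1 / 256), Nat.cast_zero, sub_zero,
    abs_of_nonpos (by nlinarith)]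
  field_simp
  ring

/-- Recursive accumulation of NONNEGATIVE data is nondecreasing (round-to-nearest is monotone and
fixes values): `ŝ_k ≤ ŝ_j` for `k ≤ j`. [folklore] -/
theorem seqSum_mono_of_nonneg {α : Format} (x : ℕ → ℚ) (hx : ∀ i, 0 ≤ x i) :
    ∀ j k : ℕ, k ≤ j → (seqSum α x k).toRat ≤ (seqSum α x j).toRat := by
  intro j
  induction j with
  | zero => intro k hk; rw [Nat.le_zero.mp hk]
  | succ j ih =>
      intro k hk
      rcases Nat.lt_or_ge k (j + 1) with hlt | hge
      · have h1 := ih k (by omega)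
        have h2 : (seqSum α x j).toRat ≤ (seqSum α x (j + 1)).toRat := by
          show (seqSum α x j).toRat ≤ (roundNE α ((seqSum α x j).toRat + x (j + 1))).toRat
          have := toRat_roundNE_mono (φ := α) (show (seqSum α x j).toRat
            ≤ (seqSum α x j).toRat + x (j + 1) by linarith [hx (j + 1)])
          rwa [toRat_roundNE_toRat] at this
        exact le_trans h1 h2
      · rw [le_antisymm hk hge]

/-- Nonnegative data accumulate to nonnegative values. [folklore] -/
theorem seqSum_nonneg_of_nonneg {α : Format} (x : ℕ → ℚ) (hx : ∀ i, 0 ≤ x i) :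
    ∀ k : ℕ, 0 ≤ (seqSum α x k).toRat
  | 0 => by
      show 0 ≤ (roundNE α (x 0)).toRat
      have := toRat_roundNE_mono (φ := α) (hx 0)
      rwa [toRat_roundNE_zero] at this
  | k + 1 => by
      show 0 ≤ (roundNE α ((seqSum α x k).toRat + x (k + 1))).toRat
      have := toRat_roundNE_mono (φ := α) (show (0 : ℚ) ≤ (seqSum α x k).toRat + x (k + 1) by
        linarith [hx (k + 1), seqSum_nonneg_of_nonneg (α := α) x hx k])
      rwa [toRat_roundNE_zero] at this

/-- Range from monotonicity: nonnegative data with `ŝₙ + max xᵢ ≤ maxRat` never leave the range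
before step `n`. [folklore] -/
theorem inRange_of_nonneg {α : Format} (x : ℕ → ℚ) (hx : ∀ i, 0 ≤ x i) (n : ℕ) {M : ℚ}
    (hM : ∀ i, x i ≤ M) (h0 : x 0 ≤ α.maxRat) (hn : (seqSum α x n).toRat + M ≤ α.maxRat) :
    InRange α x n := by
  refine ⟨by rw [abs_of_nonneg (hx 0)]; exact h0, fun k hk => ?_⟩
  have h1 := seqSum_mono_of_nonneg (α := α) x hx n k hk.le
  have h2 := seqSum_nonneg_of_nonneg (α := α) x hx k
  rw [abs_of_nonneg (by linarith [hx (k + 1)])]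
  linarith [hM (k + 1)]

/-- [LangeRump2018, Remark 2]'s example for bfloat16: `t = u + 2u² = 2^-8 + 2^-15`, data
`(1, t, u, t, u, …(128 terms)…, 2t, 2u)`. [cite: LangeRump2018, Remark 2] -/
def lrSharp (i : ℕ) : ℚ :=
  if i = 0 then 1
  else if i ≤ 128 then (if i % 2 = 1 then 1 / 256 + 2 / 65536 else 1 / 256)
  else if i = 129 then 2 * (1 / 256 + 2 / 65536) else 2 / 256

/-- KERNEL: after `k = 130` additions the accumulator is `65/32` while the exact sum (= `Σ|xᵢ|`)
is `24865/16384`. [cite: LangeRump2018, Remark 2] -/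
theorem lrSharp_eval :
    (seqSum Format.BFloat16 lrSharp 130).toRat = 65 / 32 ∧
    ∑ i ∈ range 131, lrSharp i = 24865 / 16384 ∧
    ∑ i ∈ range 131, |lrSharp i| = 24865 / 16384 := by
  refine ⟨by decide +kernel, by decide +kernel, by decide +kernel⟩

/-- THE RESTRICTION `n - 1 ≤ ½u⁻¹` CANNOT BE RELAXED TO `½u⁻¹ + 2` (bfloat16, kernel): the data
`lrSharp` (all bfloat16 values, every step in range) have `k = 130` additions and
`|ŝ - s| > 130u/(1 + 130u) · Σ|xᵢ|`. [cite: LangeRump2018, Remark 2] -/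
theorem langeRump_fails_at_130_BFloat16 :
    (∀ i ≤ 130, ∃ y : MiniFloat Format.BFloat16, y.toRat = lrSharp i) ∧
    InRange Format.BFloat16 lrSharp 130 ∧
    (130 : ℚ) * Format.BFloat16.unitRoundoff / (1 + (130 : ℚ) * Format.BFloat16.unitRoundoff)
        * ∑ i ∈ range 131, |lrSharp i|
      < |(seqSum Format.BFloat16 lrSharp 130).toRat - ∑ i ∈ range 131, lrSharp i| := by
  obtain ⟨h1, h2, h3⟩ := lrSharp_eval
  refine ⟨?_, ?_, ?_⟩
  · intro i hi
    refine ⟨roundNE Format.BFloat16 (lrSharp i), ?_⟩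
    -- every datum is a bfloat16 value: check the 131 roundings by kernel evaluation
    have hall : ∀ j ∈ List.range 131, (roundNE Format.BFloat16 (lrSharp j)).toRat = lrSharp j := by
      decide +kernel
    exact hall i (List.mem_range.mpr (by omega))
  · have hx : ∀ i, 0 ≤ lrSharp i := fun i => by unfold lrSharp; split_ifs <;> norm_num
    have hM : ∀ i, lrSharp i ≤ 1 := fun i => by unfold lrSharp; split_ifs <;> norm_num
    have hmax : (4 : ℚ) ≤ Format.BFloat16.maxRat := by decide +kernel
    refine inRange_of_nonneg lrSharp hx 130 hM (by simp [lrSharp]; linarith) ?_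
    rw [h1]; norm_num at hmax ⊢; linarith
  · rw [h1, h2, h3, Format.unitRoundoff_eq]
    norm_num [Format.BFloat16]

end MiniFloat

end Literature.ComputerArithmetic.FloatingPoint
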